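import Summits.CriticalPhenomena.PercolationContinuityZ3.Theorems.Transplant.KNCellsRun
import HarnessLib

/-!
# F8 (generic), part 3b — the RUN INVARIANT of the anchored exploration process
# (BLUEPRINT-I-PHI §3 Φ13; generalises `L/KozmaNitzanTheorem6.lean` ll. 160–300 (`RunInv`, `V_step`, `runInv`) to an anchored cell geometry)

builds on p205010 (kernel theorem, internal audit signed; external expert review pending) — nothing in this file uses p205010.
Lane `prim-bschramm`, seat `prim-bschramm-p2` (task F8 'HSR instantiation', lead V38); helper file (`--supports stmt-CriticalPhenomena-4575`).
Continuation of `KNCellsRun` (step bookkeeping `step_none` / `step_some`, frozen anchors).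

* §1 the geometric input `RunGeom G Γ` (every vertex of a cube / between-box / stub below level `K` has a `G`-neighbour inside the same set —
  the only geometry the invariant needs; `ℤ^d`: boxes of side `≥ 2`), `vspan_edgesIn_eq`, `exists_adj_of_mem_vspan_edgesIn`,
  `exists_adj_of_mem_newRegion`, `V_nil` (`E₁ = Q_0` at the root anchor);
* §2 **`RunInv`** — explored edges = edges of `G` inside the explored region; pattern = `ω` there with `U₀` open; explored region = `Q_0 ∪` the
  new regions of the probes made (each at its source anchor, departure anchor and levels read off the observation); the cube of every
  determined macro-vertex AT ITS CURRENT ARRIVAL ANCHOR is explored ((29)); the root keeps the root anchor — with `V_step` and **`runInv`**.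
[cite: KozmaNitzan2024, §4 pp. 26–27 ((29), E_{i+1}) — the ℤ^d model] [cite: GrimmettPercolation1999, §7.2]
-/

noncomputable section

open MeasureTheory ProbabilityTheory
open scoped ENNReal Classical

namespace Summit.CriticalPhenomena.PercolationContinuityZ3.Theorems

namespace Transplant

namespace KNCells

open Literature.Probability.Percolation Literature.Probability.LatticeModels SimpleGraph GadgetSystem ProbeHistory HSiteScheme
open Literature.Probability.Percolation.KozmaNitzan (opens opens_nil opens_cons_none opens_cons_some)

variable {V : Type*} [DecidableEq V]

/-! ## §1 The geometric input of the run invariant -/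

/-- **The geometry the run invariant uses**: every vertex of a cube, of a between-box and of a stub (below level `K`) has a `G`-neighbour
in the same set, so that these sets are the vertex spans of their own edges (KN: boxes of side `≥ 2` in `ℤ^d`; `X □ ℤ²`: fibre balls ×
planar boxes). [cite: KozmaNitzan2024, §4 p. 26 (Q_v, E_{v,x}, H^j_{v,x})] -/
structure RunGeom {A : Type*} (G : SimpleGraph V) (Γ : CellGeom V A) : Prop where
  adjQ : ∀ a v, ∀ y ∈ Γ.Q a v, ∃ z ∈ Γ.Q a v, G.Adj y z
  adjBtw : ∀ a v δ, ∀ y ∈ Γ.Btw a v δ, ∃ z ∈ Γ.Btw a v δ, G.Adj y z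
  adjStub : ∀ a v δ j, j < Γ.K → ∀ y ∈ Γ.Stub a v δ j, ∃ z ∈ Γ.Stub a v δ j, G.Adj y z

section Span

variable {G : SimpleGraph V} [G.LocallyFinite]

/-- **The vertex span of the edges of `G` inside `X` is `X`** when every vertex of `X` has a `G`-neighbour in `X`. [folklore] -/
theorem vspan_edgesIn_eq {X : Finset V} (h : ∀ y ∈ X, ∃ z ∈ X, G.Adj y z) : vspan (edgesIn G X) = X := by
  ext y
  rw [mem_vspan_iff]
  constructor
  · rintro ⟨e, he, hy⟩
    rw [mem_edgesIn_iff] at he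
    exact he.2 y hy
  · intro hy
    obtain ⟨z, hz, hadj⟩ := h y hy
    refine ⟨s(y, z), ?_, Sym2.mem_mk_left _ _⟩
    rw [mem_edgesIn_iff]
    refine ⟨(SimpleGraph.mem_edgeSet _).2 hadj, fun x hx => ?_⟩
    rcases Sym2.mem_iff.1 hx with rfl | rfl
    · exact hy
    · exact hz

/-- The span of the edges of `G` inside any `X` lies in `X`. [folklore] -/
theorem vspan_edgesIn_subset (X : Finset V) : vspan (edgesIn G X) ⊆ X := by
  intro y hy
  obtain ⟨e, he, hy⟩ := mem_vspan_iff.1 hy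
  rw [mem_edgesIn_iff] at he
  exact he.2 y hy

/-- A vertex of the span of the edges of `G` inside `X` has a `G`-neighbour in `X`. [folklore] -/
theorem exists_adj_of_mem_vspan_edgesIn {X : Finset V} {y : V} (hy : y ∈ vspan (edgesIn G X)) : ∃ z ∈ X, G.Adj y z := by
  obtain ⟨e, he, hye⟩ := mem_vspan_iff.1 hy
  revert he hye
  refine Sym2.ind (fun a b => ?_) e
  intro he hye
  rw [mem_edgesIn_iff] at he
  have hadj : G.Adj a b := (SimpleGraph.mem_edgeSet _).1 he.1
  rcases Sym2.mem_iff.1 hye with rfl | rfl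
  · exact ⟨b, he.2 b (Sym2.mem_mk_right _ _), hadj⟩
  · exact ⟨a, he.2 a (Sym2.mem_mk_left _ _), hadj.symm⟩

end Span

namespace KSchA

variable {A : Type*} {G : SimpleGraph V} [G.LocallyFinite] {S : KSchA V A} (hΓ : RunGeom G S.Γ)
include hΓ

/-- Every vertex of the new region has a `G`-neighbour in it. [folklore] -/
theorem exists_adj_of_mem_newRegion (h : ProbeHistory V) (e : Site 2 × MDir) (a a' : A) (o : Finset (Sym2 V))
    {y : V} (hy : y ∈ S.newRegion G h e a a' o) : ∃ z ∈ S.newRegion G h e a a' o, G.Adj y z := by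
  rcases Finset.mem_union.1 hy with hy | hy
  · rcases Finset.mem_union.1 hy with hy | hy
    · obtain ⟨z, hz, hadj⟩ := hΓ.adjBtw _ _ _ _ hy
      exact ⟨z, Finset.mem_union_left _ (Finset.mem_union_left _ hz), hadj⟩
    · obtain ⟨z, hz, hadj⟩ := hΓ.adjQ _ _ _ hy
      exact ⟨z, Finset.mem_union_left _ (Finset.mem_union_right _ hz), hadj⟩
  · obtain ⟨du, hdu, hy⟩ := Finset.mem_biUnion.1 hy
    obtain ⟨z, hz, hadj⟩ := hΓ.adjStub _ _ _ _ (S.jOf_lt (G := G) h e a a' du o) _ hy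
    exact ⟨z, Finset.mem_union_right _ (Finset.mem_biUnion.2 ⟨du, hdu, hz⟩), hadj⟩

/-- The explored region of the empty history is the root cube `Q_0` (at the root anchor). [cite: KozmaNitzan2024, §4 p. 27 (E₁ = Q_{(0,0)})] -/
theorem V_nil : S.Vx G [] = S.Γ.Q S.Γ.a₀ 0 := by
  unfold Vx F U₀
  rw [supp_nil, Finset.union_empty]
  exact vspan_edgesIn_eq fun y hy => hΓ.adjQ _ 0 _ hy

end KSchA

/-! ## §2 The run invariant -/

namespace KSchA

variable {A : Type*} {G : SimpleGraph V} [G.LocallyFinite] (S : KSchA V A)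

variable (G) in
/-- **The invariant of the run after `n` steps**: the explored edges are the edges of `G` inside the explored region; the recorded pattern is
`ω` on the explored edges, with `U₀` recorded open; the explored region consists of `Q_0` and the new regions of the probes made (each at its
source anchor, with the departure anchor and levels read off the observation); the cube of every determined macro-vertex at its current
arrival anchor is explored ((29)); the root's anchors are the root anchor. [cite: KozmaNitzan2024, §4 pp. 26–27 ((29), E_{i+1})] -/
structure RunInv (ω : BondConfig V) (n : ℕ) : Prop where
  F_eq : S.F G (S.hst G ω n) = edgesIn G (S.Vx G (S.hst G ω n))
  ξ_iff : ∀ x, x ∈ S.ξ G (S.hst G ω n) ↔ x ∈ S.F G (S.hst G ω n) ∧ (x ∈ ω ∨ x ∈ S.U₀ G)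
  V_cases : ∀ y ∈ S.Vx G (S.hst G ω n), y ∈ S.Γ.Q S.Γ.a₀ 0 ∨ ∃ m < n, ∃ e, ((S.scheme G).stN m ω).choice = some e ∧
    S.Valid G (S.hst G ω m) e ∧ (S.scheme G).E.next (S.hst G ω m) = some (S.probe G (S.hst G ω m) e (S.aOf G (S.hst G ω m) e)) ∧
    y ∈ S.newR G ω (S.hst G ω m) e
  det_Q : ∀ x, ((S.scheme G).stN n ω).Det x → S.Γ.Q ((S.astOf G (S.hst G ω n)).arr x) x ⊆ S.Vx G (S.hst G ω n)
  arr_zero : (S.astOf G (S.hst G ω n)).arr 0 = S.Γ.a₀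

variable {S}

/-- The step of the explored region at a probe: `E_{i+1} = E_i ∪ E_{w,v} ∪ ⋃_x H^{j_x}_{v,x}`, and the explored edges stay the edges of `G`
inside. [cite: KozmaNitzan2024, §4 p. 27 (E_{i+1})] -/
theorem V_step (hΓ : RunGeom G S.Γ) {ω : BondConfig V} {n : ℕ} (hI : S.RunInv G ω n) {e : Site 2 × MDir}
    (hc : ((S.scheme G).stN n ω).choice = some e)
    (hD : (S.scheme G).E.next (S.hst G ω n) = some (S.probe G (S.hst G ω n) e (S.aOf G (S.hst G ω n) e))) :
    S.F G (S.hst G ω (n + 1)) = edgesIn G (S.Vx G (S.hst G ω n) ∪ S.newR G ω (S.hst G ω n) e) ∧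
      S.Vx G (S.hst G ω (n + 1)) = S.Vx G (S.hst G ω n) ∪ S.newR G ω (S.hst G ω n) e := by
  obtain ⟨hF, -, -⟩ := S.step_some hc hD
  have hF' : S.F G (S.hst G ω (n + 1)) = edgesIn G (S.Vx G (S.hst G ω n) ∪ S.newR G ω (S.hst G ω n) e) := by
    rw [hF, revealOf, Finset.union_sdiff_self_eq_union]
    refine Finset.union_eq_right.2 ?_
    rw [hI.F_eq]
    intro x hx
    rw [mem_edgesIn_iff] at hx ⊢
    exact ⟨hx.1, fun y hy => Finset.mem_union_left _ (hx.2 y hy)⟩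
  refine ⟨hF', ?_⟩
  show vspan (S.F G (S.hst G ω (n + 1))) = _
  rw [hF']
  refine vspan_edgesIn_eq fun y hy => ?_
  rcases Finset.mem_union.1 hy with hy | hy
  · have hy' : y ∈ vspan (edgesIn G (S.Vx G (S.hst G ω n))) := by
      rw [← hI.F_eq]; exact hy
    obtain ⟨z, hz, hadj⟩ := exists_adj_of_mem_vspan_edgesIn hy'
    exact ⟨z, Finset.mem_union_left _ hz, hadj⟩
  · obtain ⟨z, hz, hadj⟩ := S.exists_adj_of_mem_newRegion hΓ _ _ _ _ _ hy
    exact ⟨z, Finset.mem_union_right _ hz, hadj⟩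

/-- **The invariant holds along the run.** [cite: KozmaNitzan2024, §4 pp. 26–27] -/
theorem runInv (hΓ : RunGeom G S.Γ) (ω : BondConfig V) : ∀ n, S.RunInv G ω n
  | 0 => by
    have hV : S.Vx G (S.hst G ω 0) = S.Γ.Q S.Γ.a₀ 0 := S.V_nil hΓ
    have hF : S.F G (S.hst G ω 0) = S.U₀ G := by
      show S.F G [] = S.U₀ G
      unfold F; rw [supp_nil, Finset.union_empty]
    refine ⟨?_, ?_, ?_, ?_, rfl⟩
    · rw [hV, hF]; rfl
    · intro x
      have hξ : S.ξ G (S.hst G ω 0) = S.U₀ G := by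
        show S.ξ G [] = S.U₀ G
        unfold ξ; rw [opens_nil, Finset.union_empty]
      rw [hξ, hF]; tauto
    · intro y hy; rw [hV] at hy; exact Or.inl hy
    · intro x hx
      have hx' : x = 0 := by
        rcases hx with hx | hx
        · simpa [HSiteScheme.stN, HSiteScheme.mst, HState.start] using hx
        · simp [HSiteScheme.stN, HSiteScheme.mst, HState.start] at hx
      subst hx'
      rw [hV]
      exact subset_of_eq rfl
  | n + 1 => by
    have hI := runInv hΓ ω n
    rcases S.next_cases (G := G) ω n with hD | ⟨e, hc, hV, hD⟩
    · obtain ⟨hF, hξ, hst, hast⟩ := S.step_none hD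
      have hVV : S.Vx G (S.hst G ω (n + 1)) = S.Vx G (S.hst G ω n) := by
        show vspan _ = vspan _; rw [hF]
      refine ⟨?_, ?_, ?_, ?_, ?_⟩
      · rw [hF, hVV]; exact hI.F_eq
      · intro x; rw [hξ, hF]; exact hI.ξ_iff x
      · intro y hy
        rw [hVV] at hy
        rcases hI.V_cases y hy with h | ⟨m, hm, rest⟩
        · exact Or.inl h
        · exact Or.inr ⟨m, by omega, rest⟩
      · intro x hx
        rw [hst] at hx; rw [hVV, hast]; exact hI.det_Q x hx
      · rw [hast]; exact hI.arr_zero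
    · obtain ⟨hF1, hξ1, hst, harr, -⟩ := S.step_some hc hD
      obtain ⟨hF2, hV2⟩ := V_step hΓ hI hc hD
      have h0ne : (0 : Site 2) ≠ tgt e := fun h0 =>
        (HState.cand_of_choice hc).2 (h0 ▸ Or.inl ((S.scheme G).inv_mst _).zero_mem)
      refine ⟨?_, ?_, ?_, ?_, ?_⟩
      · rw [hF2, hV2]
      · intro x
        rw [hξ1, hF1, Finset.mem_union, Finset.mem_union, mem_obs_iff, hI.ξ_iff x]
        constructor
        · rintro (⟨hxF, h'⟩ | ⟨hxr, hxω⟩)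
          · exact ⟨Or.inl hxF, h'⟩
          · exact ⟨Or.inr hxr, Or.inl hxω⟩
        · rintro ⟨hxF | hxr, h'⟩
          · exact Or.inl ⟨hxF, h'⟩
          · by_cases hxF : x ∈ S.F G (S.hst G ω n)
            · exact Or.inl ⟨hxF, h'⟩
            · rcases h' with h' | h'
              · exact Or.inr ⟨hxr, h'⟩
              · exact absurd (S.U₀_subset_F _ h') hxF
      · intro y hy
        rw [hV2] at hy
        rcases Finset.mem_union.1 hy with hy | hy
        · rcases hI.V_cases y hy with h | ⟨m, hm, rest⟩
          · exact Or.inl h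
          · exact Or.inr ⟨m, by omega, rest⟩
        · exact Or.inr ⟨n, Nat.lt_succ_self n, e, hc, hV, hD, hy⟩
      · intro x hx
        rw [hst] at hx
        rw [hV2, harr]
        rcases (HState.det_update_iff _ _ _).1 hx with rfl | hx
        · rw [Function.update_self]
          intro y hy
          exact Finset.mem_union_right _ (Finset.mem_union_left _ (Finset.mem_union_right _ hy))
        · have hne : x ≠ tgt e := fun h => (HState.cand_of_choice hc).2 (h ▸ hx)
          rw [Function.update_of_ne hne]
          exact (hI.det_Q x hx).trans Finset.subset_union_left
      · rw [harr, Function.update_of_ne h0ne]; exact hI.arr_zero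

end KSchA

end KNCells

end Transplant

end Summit.CriticalPhenomena.PercolationContinuityZ3.Theorems

end
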